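import Mathlib
import HarnessLib
import Summits.HubbardSuperconductivity.HubbardSuperconductivity.Theorems.ThermalWedgeTwPureThermalBoundDensityLimitB

/-!
# Route `ThermalWedge`, item `stmt-HubbardSuperconductivity-1702` (`TwPureThermalBound`):
# the abstract real analysis of the thermodynamic limit of sector energies — part C (convexity)

Support file (`--supports stmt-HubbardSuperconductivity-1702`; pure real analysis, no definition). With the
hypotheses and the limiting density `e(ν) = inf_{M ≥ 2} (E M ⌊νM²⌋/M² + (2C+T)/M)` of part B
(`ptb_tendsto_sectorDensity`): **`e` is convex on `[0, 5/4]`** (`ptb_convexOn_eLim`). Proof: tiling the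
torus of side `(k+1)M` by rows — the first `J` rows of blocks at density `ν₁`, the others at `ν₂` — gives
`e(λν₁ + (1−λ)ν₂) ≤ λe(ν₁) + (1−λ)e(ν₂)` for every `λ = J/(k+1)` (`ptb_eLim_rowConvex`); these weights are
dense in `[0,1]` and `e` is Lipschitz (part B), whence all weights. Folklore (Ruelle 1969 §3.3: the
ground-state / free energy density is convex in the density).
-/

set_option linter.dupNamespace false

noncomputable section

namespace Summit.HubbardSuperconductivity.HubbardSuperconductivity.Theorems

open Filter Set Finset
open scoped Topology BigOperators

section Abstract

variable {E : ℕ → ℕ → ℝ} {c C T F : ℝ}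

/-- Row sums of a two-valued block pattern: `Σ_i Σ_j [i < J ? A : B] = (k+1)(J A + (k+1−J) B)`. [folklore] -/
theorem ptb_sum_rowPattern {k J : ℕ} (hJ : J ≤ k + 1) (A B : ℕ) :
    ∑ i : Fin (k + 1), ∑ _j : Fin (k + 1), (if (i : ℕ) < J then A else B) =
      (k + 1) * (J * A + (k + 1 - J) * B) := by
  simp only [Finset.sum_const, Finset.card_univ, Fintype.card_fin, smul_eq_mul]
  rw [← Finset.mul_sum, Finset.sum_ite, Finset.sum_const, Finset.sum_const, smul_eq_mul, smul_eq_mul]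
  have h1 : (Finset.univ.filter fun i : Fin (k + 1) => (i : ℕ) < J).card = J := by
    rw [Fin.card_filter_val_lt, min_eq_right hJ]
  have h2 : (Finset.univ.filter fun i : Fin (k + 1) => ¬ (i : ℕ) < J).card = k + 1 - J := by
    have := Finset.card_filter_add_card_filter_not (s := (Finset.univ : Finset (Fin (k + 1))))
      (fun i : Fin (k + 1) => (i : ℕ) < J)
    rw [h1, Finset.card_univ, Fintype.card_fin] at this
    omega
  rw [h1, h2]

/-- The same with real values. [folklore] -/
theorem ptb_sum_rowPattern_real {k J : ℕ} (hJ : J ≤ k + 1) (A B : ℝ) :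
    ∑ i : Fin (k + 1), ∑ _j : Fin (k + 1), (if (i : ℕ) < J then A else B) =
      ((k : ℝ) + 1) * (J * A + ((k : ℝ) + 1 - J) * B) := by
  simp only [Finset.sum_const, Finset.card_univ, Fintype.card_fin, nsmul_eq_mul]
  rw [← Finset.mul_sum, Finset.sum_ite, Finset.sum_const, Finset.sum_const, nsmul_eq_mul, nsmul_eq_mul]
  have h1 : (Finset.univ.filter fun i : Fin (k + 1) => (i : ℕ) < J).card = J := by
    rw [Fin.card_filter_val_lt, min_eq_right hJ]
  have h2 : (Finset.univ.filter fun i : Fin (k + 1) => ¬ (i : ℕ) < J).card = k + 1 - J := by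
    have := Finset.card_filter_add_card_filter_not (s := (Finset.univ : Finset (Fin (k + 1))))
      (fun i : Fin (k + 1) => (i : ℕ) < J)
    rw [h1, Finset.card_univ, Fintype.card_fin] at this
    omega
  rw [h1, h2]
  push_cast
  rw [Nat.cast_sub hJ]
  push_cast
  ring

/-- **The finite-volume row-convexity inequality.** For `ν₁, ν₂ ∈ [0, 5/4]`, `J ≤ k+1`, `M ≥ 2`, with
`ν̄ = (Jν₁ + (k+1−J)ν₂)/(k+1)`:
`E ((k+1)M) ⌊ν̄((k+1)M)²⌋ ≤ (k+1)(J (E M ⌊ν₁M²⌋ + C) + (k+1−J)(E M ⌊ν₂M²⌋ + C)) + T M k (k+1) + C((k+1)² + 1)`.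
[folklore] -/
theorem ptb_rowConvex_finite (hC : 0 ≤ C)
    (hup : ∀ L K : ℕ, 2 * (K + 1) ≤ 3 * L ^ 2 → E L (K + 1) ≤ E L K + C)
    (hdn : ∀ L K : ℕ, 1 ≤ K → K ≤ 2 * L ^ 2 → E L (K - 1) ≤ E L K + C)
    (htile : ∀ (M k : ℕ) (Ns : Fin (k + 1) → Fin (k + 1) → ℕ), (∀ i j, Ns i j ≤ 2 * (M * M)) →
      E ((k + 1) * M) (∑ i, ∑ j, Ns i j) ≤ ∑ i, ∑ j, E M (Ns i j) + T * M * k * (k + 1))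
    {ν₁ ν₂ : ℝ} (h10 : 0 ≤ ν₁) (h1 : ν₁ ≤ 5 / 4) (h20 : 0 ≤ ν₂) (h2 : ν₂ ≤ 5 / 4)
    (k J M : ℕ) (hJ : J ≤ k + 1) (hM : 2 ≤ M) :
    E ((k + 1) * M) ⌊((J : ℝ) * ν₁ + ((k : ℝ) + 1 - J) * ν₂) / ((k : ℝ) + 1) * ((((k + 1) * M : ℕ) : ℝ)) ^ 2⌋₊ ≤
      ((k : ℝ) + 1) * (J * (E M ⌊ν₁ * (M : ℝ) ^ 2⌋₊ + C) + ((k : ℝ) + 1 - J) * (E M ⌊ν₂ * (M : ℝ) ^ 2⌋₊ + C)) +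
        T * M * k * (k + 1) + C * (((k : ℝ) + 1) ^ 2 + 1) := by
  set q₁ : ℕ := ⌊ν₁ * (M : ℝ) ^ 2⌋₊ with hq₁
  set q₂ : ℕ := ⌊ν₂ * (M : ℝ) ^ 2⌋₊ with hq₂
  set νb : ℝ := ((J : ℝ) * ν₁ + ((k : ℝ) + 1 - J) * ν₂) / ((k : ℝ) + 1) with hνb
  set P : ℕ := ⌊νb * ((((k + 1) * M : ℕ) : ℝ)) ^ 2⌋₊ with hP
  have hk : (0 : ℝ) < (k : ℝ) + 1 := by positivity
  have hJr : (J : ℝ) ≤ (k : ℝ) + 1 := by exact_mod_cast hJ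
  have hMpos : (0 : ℝ) < M := by exact_mod_cast lt_of_lt_of_le zero_lt_two hM
  -- block sizes
  have hq₁1 : q₁ + 1 ≤ 2 * (M * M) := by have h := ptb_two_floor_succ_le h10 h1 hM; rw [← hq₁] at h; nlinarith
  have hq₂1 : q₂ + 1 ≤ 2 * (M * M) := by have h := ptb_two_floor_succ_le h20 h2 hM; rw [← hq₂] at h; nlinarith
  -- the row pattern
  set Ns : Fin (k + 1) → Fin (k + 1) → ℕ := fun i _ => if (i : ℕ) < J then q₁ + 1 else q₂ + 1 with hNs
  have hNsle : ∀ i j, Ns i j ≤ 2 * (M * M) := by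
    intro i j; simp only [hNs]; split_ifs
    · exact hq₁1
    · exact hq₂1
  have ht := htile M k Ns hNsle
  have hsumNs : ∑ i, ∑ j, Ns i j = (k + 1) * (J * (q₁ + 1) + (k + 1 - J) * (q₂ + 1)) := ptb_sum_rowPattern hJ _ _
  have hsumE : ∑ i : Fin (k + 1), ∑ j : Fin (k + 1), E M (Ns i j) =
      ((k : ℝ) + 1) * (J * E M (q₁ + 1) + ((k : ℝ) + 1 - J) * E M (q₂ + 1)) := by
    have : ∀ i j, E M (Ns i j) = if (i : ℕ) < J then E M (q₁ + 1) else E M (q₂ + 1) := by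
      intro i j; simp only [hNs]; split_ifs <;> rfl
    simp_rw [this]
    exact ptb_sum_rowPattern_real hJ _ _
  rw [hsumNs, hsumE] at ht
  set S : ℕ := (k + 1) * (J * (q₁ + 1) + (k + 1 - J) * (q₂ + 1)) with hS
  -- `P ≤ S` and `S − P ≤ (k+1)² + 1`
  have hν₁M : ν₁ * (M : ℝ) ^ 2 < q₁ + 1 := Nat.lt_floor_add_one _
  have hν₂M : ν₂ * (M : ℝ) ^ 2 < q₂ + 1 := Nat.lt_floor_add_one _
  have hq₁le : (q₁ : ℝ) ≤ ν₁ * (M : ℝ) ^ 2 := Nat.floor_le (by positivity)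
  have hq₂le : (q₂ : ℝ) ≤ ν₂ * (M : ℝ) ^ 2 := Nat.floor_le (by positivity)
  have hSr : (S : ℝ) = ((k : ℝ) + 1) * (J * (q₁ + 1) + ((k : ℝ) + 1 - J) * (q₂ + 1)) := by
    rw [hS]; push_cast; rw [Nat.cast_sub hJ]; push_cast; ring
  have hνbvol : νb * ((((k + 1) * M : ℕ) : ℝ)) ^ 2 = ((k : ℝ) + 1) * ((J : ℝ) * (ν₁ * (M : ℝ) ^ 2) +
      ((k : ℝ) + 1 - J) * (ν₂ * (M : ℝ) ^ 2)) := by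
    rw [hνb]; push_cast; field_simp
  have hνb0 : 0 ≤ νb * ((((k + 1) * M : ℕ) : ℝ)) ^ 2 := by
    rw [hνbvol]
    have : 0 ≤ (k : ℝ) + 1 - J := by linarith
    positivity
  have hkJ : 0 ≤ (k : ℝ) + 1 - J := by linarith
  have hPS : P ≤ S := by
    have h1 : (P : ℝ) ≤ νb * ((((k + 1) * M : ℕ) : ℝ)) ^ 2 := Nat.floor_le hνb0
    have i1 : (J : ℝ) * (ν₁ * (M : ℝ) ^ 2) ≤ J * ((q₁ : ℝ) + 1) := mul_le_mul_of_nonneg_left hν₁M.le (Nat.cast_nonneg J)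
    have i2 : ((k : ℝ) + 1 - J) * (ν₂ * (M : ℝ) ^ 2) ≤ ((k : ℝ) + 1 - J) * ((q₂ : ℝ) + 1) :=
      mul_le_mul_of_nonneg_left hν₂M.le hkJ
    have h2 : νb * ((((k + 1) * M : ℕ) : ℝ)) ^ 2 ≤ S := by
      rw [hνbvol, hSr]
      exact mul_le_mul_of_nonneg_left (add_le_add i1 i2) hk.le
    exact_mod_cast h1.trans h2
  have hSP : ((S - P : ℕ) : ℝ) ≤ ((k : ℝ) + 1) ^ 2 + 1 := by
    rw [Nat.cast_sub hPS]
    have h1 : νb * ((((k + 1) * M : ℕ) : ℝ)) ^ 2 < P + 1 := Nat.lt_floor_add_one _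
    have i1 : (J : ℝ) * q₁ ≤ J * (ν₁ * (M : ℝ) ^ 2) := mul_le_mul_of_nonneg_left hq₁le (Nat.cast_nonneg J)
    have i2 : ((k : ℝ) + 1 - J) * q₂ ≤ ((k : ℝ) + 1 - J) * (ν₂ * (M : ℝ) ^ 2) := mul_le_mul_of_nonneg_left hq₂le hkJ
    have h2 : ((k : ℝ) + 1) * ((J : ℝ) * q₁ + ((k : ℝ) + 1 - J) * q₂) ≤ νb * ((((k + 1) * M : ℕ) : ℝ)) ^ 2 := by
      rw [hνbvol]
      exact mul_le_mul_of_nonneg_left (add_le_add i1 i2) hk.le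
    have h3 : (S : ℝ) - ((k : ℝ) + 1) * ((J : ℝ) * q₁ + ((k : ℝ) + 1 - J) * q₂) = ((k : ℝ) + 1) ^ 2 := by
      rw [hSr]; ring
    linarith only [h1, h2, h3]
  -- down-steps from `S` to `P`, block up-steps
  have hS2 : S ≤ 2 * ((k + 1) * M) ^ 2 := by
    have h1 : J * (q₁ + 1) + (k + 1 - J) * (q₂ + 1) ≤ (k + 1) * (2 * (M * M)) := by
      have a1 : J * (q₁ + 1) ≤ J * (2 * (M * M)) := Nat.mul_le_mul_left _ hq₁1
      have a2 : (k + 1 - J) * (q₂ + 1) ≤ (k + 1 - J) * (2 * (M * M)) := Nat.mul_le_mul_left _ hq₂1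
      have : J * (2 * (M * M)) + (k + 1 - J) * (2 * (M * M)) = (k + 1) * (2 * (M * M)) := by
        rw [← Nat.add_mul, Nat.add_sub_cancel' hJ]
      omega
    calc S = (k + 1) * (J * (q₁ + 1) + (k + 1 - J) * (q₂ + 1)) := hS
      _ ≤ (k + 1) * ((k + 1) * (2 * (M * M))) := Nat.mul_le_mul_left _ h1
      _ = 2 * ((k + 1) * M) ^ 2 := by ring
  have hdown := ptb_E_sub_le hdn ((k + 1) * M) S (S - P) hS2 (Nat.sub_le _ _)
  rw [Nat.sub_sub_self hPS] at hdown
  have hb1 := hup M q₁ (ptb_two_floor_succ_le h10 h1 hM)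
  have hb2 := hup M q₂ (ptb_two_floor_succ_le h20 h2 hM)
  have i1 : (J : ℝ) * E M (q₁ + 1) ≤ J * (E M q₁ + C) := mul_le_mul_of_nonneg_left hb1 (Nat.cast_nonneg J)
  have i2 : ((k : ℝ) + 1 - J) * E M (q₂ + 1) ≤ ((k : ℝ) + 1 - J) * (E M q₂ + C) := mul_le_mul_of_nonneg_left hb2 hkJ
  have e1 : ((k : ℝ) + 1) * (J * E M (q₁ + 1) + ((k : ℝ) + 1 - J) * E M (q₂ + 1)) ≤
      ((k : ℝ) + 1) * (J * (E M q₁ + C) + ((k : ℝ) + 1 - J) * (E M q₂ + C)) :=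
    mul_le_mul_of_nonneg_left (add_le_add i1 i2) hk.le
  have e2 : C * ((S - P : ℕ) : ℝ) ≤ C * (((k : ℝ) + 1) ^ 2 + 1) := mul_le_mul_of_nonneg_left hSP hC
  linarith only [ht, hdown, e1, e2]

/-- **Row convexity of the limit**: for `ν₁, ν₂ ∈ [0, 5/4]` and `λ = J/(k+1)` (`J ≤ k+1`),
`e(λν₁ + (1−λ)ν₂) ≤ λ e(ν₁) + (1−λ) e(ν₂)`. [folklore] -/
theorem ptb_eLim_rowConvex (hc : 0 ≤ c) (hC : 0 ≤ C) (hT : 0 ≤ T) (hF : 0 ≤ F)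
    (hlow : ∀ L K : ℕ, K ≤ 2 * L ^ 2 → -(c * (L : ℝ) ^ 2) ≤ E L K)
    (hup : ∀ L K : ℕ, 2 * (K + 1) ≤ 3 * L ^ 2 → E L (K + 1) ≤ E L K + C)
    (hdn : ∀ L K : ℕ, 1 ≤ K → K ≤ 2 * L ^ 2 → E L (K - 1) ≤ E L K + C)
    (htile : ∀ (M k : ℕ) (Ns : Fin (k + 1) → Fin (k + 1) → ℕ), (∀ i j, Ns i j ≤ 2 * (M * M)) →
      E ((k + 1) * M) (∑ i, ∑ j, Ns i j) ≤ ∑ i, ∑ j, E M (Ns i j) + T * M * k * (k + 1))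
    (hfill : ∀ (ℓ r N NB : ℕ), N ≤ 2 * (ℓ * ℓ) → NB ≤ 2 * (r * ℓ + r * (ℓ + r)) →
      E (ℓ + r) (N + NB) ≤ E ℓ N + F * ((r * ℓ + r * (ℓ + r) : ℕ) + (2 * ℓ + r : ℕ)))
    {ν₁ ν₂ : ℝ} (h10 : 0 ≤ ν₁) (h1 : ν₁ ≤ 5 / 4) (h20 : 0 ≤ ν₂) (h2 : ν₂ ≤ 5 / 4)
    (k J : ℕ) (hJ : J ≤ k + 1) :
    sInf ((fun M : ℕ => E M ⌊(((J : ℝ) * ν₁ + ((k : ℝ) + 1 - J) * ν₂) / ((k : ℝ) + 1)) * (M : ℝ) ^ 2⌋₊ / (M : ℝ) ^ 2 +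
        (2 * C + T) / M) '' {M | 2 ≤ M}) ≤
      (J : ℝ) / ((k : ℝ) + 1) * sInf ((fun M : ℕ => E M ⌊ν₁ * (M : ℝ) ^ 2⌋₊ / (M : ℝ) ^ 2 + (2 * C + T) / M) '' {M | 2 ≤ M}) +
      (1 - (J : ℝ) / ((k : ℝ) + 1)) * sInf ((fun M : ℕ => E M ⌊ν₂ * (M : ℝ) ^ 2⌋₊ / (M : ℝ) ^ 2 + (2 * C + T) / M) '' {M | 2 ≤ M}) := by
  set νb : ℝ := ((J : ℝ) * ν₁ + ((k : ℝ) + 1 - J) * ν₂) / ((k : ℝ) + 1) with hνb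
  have hk : (0 : ℝ) < (k : ℝ) + 1 := by positivity
  have hJr : (J : ℝ) ≤ (k : ℝ) + 1 := by exact_mod_cast hJ
  set lam : ℝ := (J : ℝ) / ((k : ℝ) + 1) with hlam
  have hlam0 : 0 ≤ lam := by positivity
  have hlam1 : lam ≤ 1 := by rw [hlam, div_le_one hk]; exact hJr
  have hνb' : νb = lam * ν₁ + (1 - lam) * ν₂ := by rw [hνb, hlam]; field_simp
  have hνb0 : 0 ≤ νb := by rw [hνb']; nlinarith
  have hνb1 : νb ≤ 5 / 4 := by rw [hνb']; nlinarith
  -- the three limits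
  have hL0 := ptb_tendsto_sectorDensity hc hC hT hF hlow hup hdn htile hfill hνb0 hνb1
  have hL1 := ptb_tendsto_sectorDensity hc hC hT hF hlow hup hdn htile hfill h10 h1
  have hL2 := ptb_tendsto_sectorDensity hc hC hT hF hlow hup hdn htile hfill h20 h2
  -- along the subsequence `M ↦ (k+1)M`
  have hsub : Tendsto (fun M : ℕ => (k + 1) * M) atTop atTop :=
    tendsto_id.const_mul_atTop' (Nat.succ_pos k)
  have hL0' := hL0.comp hsub
  -- the finite-volume inequality, in density form, eventually
  set e₁ := sInf ((fun M : ℕ => E M ⌊ν₁ * (M : ℝ) ^ 2⌋₊ / (M : ℝ) ^ 2 + (2 * C + T) / M) '' {M | 2 ≤ M}) with he₁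
  set e₂ := sInf ((fun M : ℕ => E M ⌊ν₂ * (M : ℝ) ^ 2⌋₊ / (M : ℝ) ^ 2 + (2 * C + T) / M) '' {M | 2 ≤ M}) with he₂
  set D : ℝ := 3 * C + T with hD
  have hrhs : Tendsto (fun M : ℕ => lam * (E M ⌊ν₁ * (M : ℝ) ^ 2⌋₊ / (M : ℝ) ^ 2) +
      (1 - lam) * (E M ⌊ν₂ * (M : ℝ) ^ 2⌋₊ / (M : ℝ) ^ 2) + D / M) atTop (𝓝 (lam * e₁ + (1 - lam) * e₂ + 0)) :=
    ((hL1.const_mul lam).add (hL2.const_mul (1 - lam))).add (tendsto_const_nhds.div_atTop tendsto_natCast_atTop_atTop)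
  rw [add_zero] at hrhs
  refine le_of_tendsto_of_tendsto hL0' hrhs ?_
  filter_upwards [eventually_ge_atTop 2] with M hM
  have hM1 : (1 : ℝ) ≤ M := by exact_mod_cast le_trans one_le_two hM
  have hMpos : (0 : ℝ) < M := by linarith
  have hfin := ptb_rowConvex_finite hC hup hdn htile h10 h1 h20 h2 k J M hJ hM
  rw [Function.comp_apply]
  have hvol : ((((k + 1) * M : ℕ) : ℝ)) ^ 2 = ((k : ℝ) + 1) ^ 2 * (M : ℝ) ^ 2 := by push_cast; ring
  have hvol0 : (0 : ℝ) < ((((k + 1) * M : ℕ) : ℝ)) ^ 2 := by rw [hvol]; positivity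
  rw [div_le_iff₀ hvol0]
  refine hfin.trans ?_
  have expand : (lam * (E M ⌊ν₁ * (M : ℝ) ^ 2⌋₊ / (M : ℝ) ^ 2) + (1 - lam) * (E M ⌊ν₂ * (M : ℝ) ^ 2⌋₊ / (M : ℝ) ^ 2) +
      D / M) * ((((k + 1) * M : ℕ) : ℝ)) ^ 2 =
      ((k : ℝ) + 1) * (J * E M ⌊ν₁ * (M : ℝ) ^ 2⌋₊ + ((k : ℝ) + 1 - J) * E M ⌊ν₂ * (M : ℝ) ^ 2⌋₊) +
        (3 * C + T) * (((k : ℝ) + 1) ^ 2 * M) := by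
    rw [hvol, hlam, hD]
    field_simp
  rw [expand]
  have hk2 : (0 : ℝ) ≤ ((k : ℝ) + 1) ^ 2 := by positivity
  have hkM : ((k : ℝ) + 1) ^ 2 * 1 ≤ ((k : ℝ) + 1) ^ 2 * M := mul_le_mul_of_nonneg_left hM1 hk2
  have ha : C * ((k : ℝ) + 1) ^ 2 ≤ C * (((k : ℝ) + 1) ^ 2 * M) := by
    apply mul_le_mul_of_nonneg_left _ hC; linarith only [hkM]
  have hb : C * (((k : ℝ) + 1) ^ 2 + 1) ≤ 2 * C * (((k : ℝ) + 1) ^ 2 * M) := by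
    have h1 : (1 : ℝ) ≤ ((k : ℝ) + 1) ^ 2 := one_le_pow₀ (by linarith only [hk] : (1 : ℝ) ≤ (k : ℝ) + 1)
    have h2 : ((k : ℝ) + 1) ^ 2 + 1 ≤ 2 * (((k : ℝ) + 1) ^ 2 * M) := by linarith only [h1, hkM]
    have h3 := mul_le_mul_of_nonneg_left h2 hC
    linarith only [h3]
  have hc' : T * M * k * (k + 1) ≤ T * (((k : ℝ) + 1) ^ 2 * M) := by
    have h1 : (k : ℝ) * (k + 1) ≤ ((k : ℝ) + 1) ^ 2 := by nlinarith only [Nat.cast_nonneg (α := ℝ) k]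
    have h2 : (M : ℝ) * ((k : ℝ) * (k + 1)) ≤ (M : ℝ) * ((k : ℝ) + 1) ^ 2 := mul_le_mul_of_nonneg_left h1 hMpos.le
    have h3 := mul_le_mul_of_nonneg_left h2 hT
    have e : T * M * k * (k + 1) = T * ((M : ℝ) * ((k : ℝ) * (k + 1))) := by ring
    have e' : T * (((k : ℝ) + 1) ^ 2 * M) = T * ((M : ℝ) * ((k : ℝ) + 1) ^ 2) := by ring
    rw [e, e']; exact h3
  have hid : ((k : ℝ) + 1) * (J * (E M ⌊ν₁ * (M : ℝ) ^ 2⌋₊ + C) + ((k : ℝ) + 1 - J) * (E M ⌊ν₂ * (M : ℝ) ^ 2⌋₊ + C)) =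
      ((k : ℝ) + 1) * (J * E M ⌊ν₁ * (M : ℝ) ^ 2⌋₊ + ((k : ℝ) + 1 - J) * E M ⌊ν₂ * (M : ℝ) ^ 2⌋₊) + C * ((k : ℝ) + 1) ^ 2 := by
    ring
  rw [hid]
  linarith only [ha, hb, hc']

/-- The dyadic-free approximation of a weight: `⌊a(k+1)⌋/(k+1) → a` for `a ∈ [0,1]`. [folklore] -/
theorem ptb_tendsto_floor_weight {a : ℝ} (ha0 : 0 ≤ a) :
    Tendsto (fun k : ℕ => (⌊a * ((k : ℝ) + 1)⌋₊ : ℝ) / ((k : ℝ) + 1)) atTop (𝓝 a) := by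
  have hup : ∀ k : ℕ, (⌊a * ((k : ℝ) + 1)⌋₊ : ℝ) / ((k : ℝ) + 1) ≤ a := fun k => by
    have hk : (0 : ℝ) < (k : ℝ) + 1 := by positivity
    rw [div_le_iff₀ hk]
    exact Nat.floor_le (by positivity)
  have hlow : ∀ k : ℕ, a - 1 / ((k : ℝ) + 1) ≤ (⌊a * ((k : ℝ) + 1)⌋₊ : ℝ) / ((k : ℝ) + 1) := fun k => by
    have hk : (0 : ℝ) < (k : ℝ) + 1 := by positivity
    rw [sub_le_iff_le_add, ← add_div, le_div_iff₀ hk]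
    have := Nat.lt_floor_add_one (a * ((k : ℝ) + 1))
    linarith
  have h0 : Tendsto (fun k : ℕ => a - 1 / ((k : ℝ) + 1)) atTop (𝓝 (a - 0)) := by
    refine tendsto_const_nhds.sub ?_
    have h := tendsto_one_div_add_atTop_nhds_zero_nat (𝕜 := ℝ)
    exact h
  rw [sub_zero] at h0
  exact tendsto_of_tendsto_of_tendsto_of_le_of_le h0 tendsto_const_nhds hlow hup

/-- **`e` is convex on `[0, 5/4]`** (row convexity at the dense weights `⌊a(k+1)⌋/(k+1)` and the Lipschitz
continuity of `e`). [folklore] -/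
theorem ptb_convexOn_eLim (hc : 0 ≤ c) (hC : 0 ≤ C) (hT : 0 ≤ T) (hF : 0 ≤ F)
    (hlow : ∀ L K : ℕ, K ≤ 2 * L ^ 2 → -(c * (L : ℝ) ^ 2) ≤ E L K)
    (hup : ∀ L K : ℕ, 2 * (K + 1) ≤ 3 * L ^ 2 → E L (K + 1) ≤ E L K + C)
    (hdn : ∀ L K : ℕ, 1 ≤ K → K ≤ 2 * L ^ 2 → E L (K - 1) ≤ E L K + C)
    (htile : ∀ (M k : ℕ) (Ns : Fin (k + 1) → Fin (k + 1) → ℕ), (∀ i j, Ns i j ≤ 2 * (M * M)) →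
      E ((k + 1) * M) (∑ i, ∑ j, Ns i j) ≤ ∑ i, ∑ j, E M (Ns i j) + T * M * k * (k + 1))
    (hfill : ∀ (ℓ r N NB : ℕ), N ≤ 2 * (ℓ * ℓ) → NB ≤ 2 * (r * ℓ + r * (ℓ + r)) →
      E (ℓ + r) (N + NB) ≤ E ℓ N + F * ((r * ℓ + r * (ℓ + r) : ℕ) + (2 * ℓ + r : ℕ))) :
    ConvexOn ℝ (Icc (0 : ℝ) (5 / 4))
      (fun ν : ℝ => sInf ((fun M : ℕ => E M ⌊ν * (M : ℝ) ^ 2⌋₊ / (M : ℝ) ^ 2 + (2 * C + T) / M) '' {M | 2 ≤ M})) := by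
  refine ⟨convex_Icc _ _, ?_⟩
  intro x hx y hy a b ha hb hab
  obtain ⟨hx0, hx1⟩ := hx
  obtain ⟨hy0, hy1⟩ := hy
  have hb' : b = 1 - a := by linarith
  subst hb'
  have ha1 : a ≤ 1 := by linarith
  -- notation-free abbreviations
  set e : ℝ → ℝ := fun ν => sInf ((fun M : ℕ => E M ⌊ν * (M : ℝ) ^ 2⌋₊ / (M : ℝ) ^ 2 + (2 * C + T) / M) '' {M | 2 ≤ M})
    with he
  set lam : ℕ → ℝ := fun k => (⌊a * ((k : ℝ) + 1)⌋₊ : ℝ) / ((k : ℝ) + 1) with hlam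
  set p : ℕ → ℝ := fun k => ((⌊a * ((k : ℝ) + 1)⌋₊ : ℝ) * x + ((k : ℝ) + 1 - ⌊a * ((k : ℝ) + 1)⌋₊) * y) / ((k : ℝ) + 1)
    with hp
  have hJ : ∀ k : ℕ, ⌊a * ((k : ℝ) + 1)⌋₊ ≤ k + 1 := fun k => by
    have h : (⌊a * ((k : ℝ) + 1)⌋₊ : ℝ) ≤ a * ((k : ℝ) + 1) := Nat.floor_le (by positivity)
    have h2 : a * ((k : ℝ) + 1) ≤ (k : ℝ) + 1 := by nlinarith
    exact_mod_cast h.trans h2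
  have hpk : ∀ k : ℕ, p k = lam k * x + (1 - lam k) * y := fun k => by
    have hk : (0 : ℝ) < (k : ℝ) + 1 := by positivity
    simp only [hp, hlam]; field_simp
  have hlam01 : ∀ k : ℕ, 0 ≤ lam k ∧ lam k ≤ 1 := fun k => by
    have hk : (0 : ℝ) < (k : ℝ) + 1 := by positivity
    refine ⟨by positivity, ?_⟩
    simp only [hlam]; rw [div_le_one hk]; exact_mod_cast hJ k
  -- row convexity at every `k`
  have hrow : ∀ k : ℕ, e (p k) ≤ lam k * e x + (1 - lam k) * e y := fun k =>
    ptb_eLim_rowConvex hc hC hT hF hlow hup hdn htile hfill hx0 hx1 hy0 hy1 k _ (hJ k)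
  -- limits of the two sides
  have hlamT : Tendsto lam atTop (𝓝 a) := ptb_tendsto_floor_weight ha
  have hrhs : Tendsto (fun k => lam k * e x + (1 - lam k) * e y) atTop (𝓝 (a * e x + (1 - a) * e y)) :=
    (hlamT.mul_const _).add (((tendsto_const_nhds (x := (1 : ℝ))).sub hlamT).mul_const _)
  have hpT : Tendsto p atTop (𝓝 (a * x + (1 - a) * y)) := by
    have h1 : Tendsto (fun k => lam k * x + (1 - lam k) * y) atTop (𝓝 (a * x + (1 - a) * y)) :=
      (hlamT.mul_const x).add (((tendsto_const_nhds (x := (1 : ℝ))).sub hlamT).mul_const y)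
    exact h1.congr fun k => (hpk k).symm
  -- `e` is continuous along `p k → a x + (1-a) y` inside `[0, 5/4]` (Lipschitz)
  have hmem : ∀ k : ℕ, 0 ≤ p k ∧ p k ≤ 5 / 4 := fun k => by
    obtain ⟨h0, h1⟩ := hlam01 k
    rw [hpk k]; constructor <;> nlinarith
  have hq0 : 0 ≤ a * x + (1 - a) * y := by nlinarith
  have hq1 : a * x + (1 - a) * y ≤ 5 / 4 := by nlinarith
  have hlhs : Tendsto (fun k => e (p k)) atTop (𝓝 (e (a * x + (1 - a) * y))) := by
    rw [Metric.tendsto_atTop]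
    intro ε hε
    have hpT' := Metric.tendsto_atTop.1 hpT (ε / (C + 1)) (by positivity)
    obtain ⟨N, hN⟩ := hpT'
    refine ⟨N, fun k hk => ?_⟩
    have hd := hN k hk
    rw [Real.dist_eq] at hd ⊢
    have hLip := ptb_abs_eLim_sub_le hc hC hT hF hlow hup hdn htile hfill (hmem k).1 (hmem k).2 hq0 hq1
    change |e (p k) - e (a * x + (1 - a) * y)| ≤ C * |p k - (a * x + (1 - a) * y)| at hLip
    have hC1 : C * |p k - (a * x + (1 - a) * y)| ≤ C * (ε / (C + 1)) := mul_le_mul_of_nonneg_left hd.le hC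
    have hC2 : C * (ε / (C + 1)) < ε := by
      rw [mul_div_assoc']; rw [div_lt_iff₀ (by positivity)]; nlinarith
    linarith
  have key := le_of_tendsto_of_tendsto hlhs hrhs (Eventually.of_forall hrow)
  simpa only [smul_eq_mul] using key

end Abstract

end Summit.HubbardSuperconductivity.HubbardSuperconductivity.Theorems

end
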